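import Literature.AlgebraicGeometry.ShimuraVarieties.UnitaryBallQuotientDatum
import Literature.NumberTheory.Automorphic.UnitaryGroupFormTransport
import HarnessLib

/-!
# `U(J) ≅ U(1,1)` acts transitively on the negative lines of a hermitian plane of signature `(1,1)`

Literature layer — REPRODUCTION (kernel proofs only: no records, no `Prop` definitions, no new data).

Let `J ∈ M₂(ℂ)` be a hermitian matrix of signature `(1,1)`, presented by a FRAME `T ∈ GL₂(ℂ)` with
`Tᴴ J T = diag(1,-1)` (the tree's currency `formCongr (starRingEnd ℂ) T J = Matrix.diagonal ![1, -1]`, as in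
`UnitaryShimuraCurveCanonicalModelExists` / the face lemma `gsFace_frame`).  The open negative cone
`negCone J = {v | ⟪v,v⟫_J < 0} ⊂ ℂ²` (`UnitaryBallQuotientDatum.negCone`) is a union of punctured lines and its image in
`ℙ¹(ℂ)` is the disc `𝔻 ≅ U(1,1)/(U(1) × U(1))` of negative lines.  We PROVE that the unitary group
`U(J) = {g | gᴴ J g = J}` (`unitaryGroupOfForm (starRingEnd ℂ) J`) acts TRANSITIVELY on negative lines:

* `re_hermForm_diagonal_self` / `mem_negCone_diagonal_iff` — in the Sylvester frame, `⟪y,y⟫ = |y₀|² − |y₁|²`, so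
  `y` is negative iff `|y₀|² < |y₁|²`;
* `exists_mem_unitaryGroupOfForm_diagonal_mulVec_single_eq` — the explicit BOOST
  `r⁻¹ · !![conj y₁, y₀; conj y₀, y₁]`, `r² = |y₁|² − |y₀|²`, lies in `U(diag(1,-1))` and carries the base vector
  `e₁ = (0,1)` to `r⁻¹ · y`;
* `exists_mem_unitaryGroupOfForm_diagonal_mulVec_eq_smul` — hence `U(diag(1,-1))` is transitive on negative vectors up
  to non-zero scalars;
* `hermForm_formCongr_self` / `inv_mulVec_mem_negCone` — the frame `T` carries `negCone J` onto `negCone (Tᴴ J T)`;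
* `exists_mem_unitaryGroupOfForm_mulVec_eq_smul` — **for every `v, w ∈ negCone J` there are `g ∈ U(J)` and `c ≠ 0`
  with `g v = c · w`** (transport along `g ↦ T g T⁻¹`, ★ `conj_mem_unitaryGroupOfForm`).

This is the rank-2 («disc») counterpart of the transitivity of `U(2,1)` on the ball `𝔹²` used throughout the tree's
ball-quotient files; it is the archimedean input for the cocompactness of arithmetic subgroups of `U(J⋆)` on
`negCone(J⋆^τ)` (road (ii) of the `hodgecm-mathlib` GS programme, leaf R2-1-inj (S2)).  Nothing here is specific to
that programme.

References: S. Helgason, *Differential Geometry, Lie Groups, and Symmetric Spaces* (1978), Ch. X §2 (the hermitian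
symmetric space `SU(1,1)/U(1)` = unit disc); N. Bergeron, J. Millson, C. Moeglin, Acta Math. 216 (2016), Part 2 §1.3
(the space of negative lines of a hermitian form of signature `(p,1)`); A. W. Knapp, *Lie Groups Beyond an
Introduction* (2002), I §1 (the groups `U(p,q)`).  Everything below is PROVED. [folklore]
-/

set_option autoImplicit false

noncomputable section

open Matrix Complex ComplexConjugate
open scoped Matrix MatrixGroups

namespace Literature.NumberTheory.Automorphic

open Literature.AlgebraicGeometry.ShimuraVarieties

/-! ## §1 The Sylvester form `diag(1,-1)`: negativity and the boost -/

section Diagonal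

/-- The signature-`(1,1)` Sylvester form `diag(1,-1)` evaluated on a vector: `Re ⟪y,y⟫ = |y₀|² − |y₁|²`.
[cite: Knapp2002, I §1] -/
theorem re_hermForm_diagonal_self (y : Fin 2 → ℂ) :
    (hermForm (starRingEnd ℂ) (Matrix.diagonal ![(1 : ℂ), -1]) y y).re = ‖y 0‖ ^ 2 - ‖y 1‖ ^ 2 := by
  have h : hermForm (starRingEnd ℂ) (Matrix.diagonal ![(1 : ℂ), -1]) y y =
      ((‖y 0‖ : ℝ) : ℂ) ^ 2 - ((‖y 1‖ : ℝ) : ℂ) ^ 2 := by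
    rw [hermForm_starRingEnd, dotProduct, Fin.sum_univ_two, mulVec_diagonal, mulVec_diagonal]
    simp only [Pi.star_apply, Complex.star_def, Matrix.cons_val_zero, Matrix.cons_val_one]
    rw [← Complex.conj_mul', ← Complex.conj_mul']
    ring
  rw [h, ← Complex.ofReal_pow, ← Complex.ofReal_pow, ← Complex.ofReal_sub, Complex.ofReal_re]

/-- **Negativity in the Sylvester frame**: `y ∈ negCone diag(1,-1) ↔ |y₀|² < |y₁|²`.
[cite: BergeronMillsonMoeglin2016Balls, Part 2 §1.3] -/
theorem mem_negCone_diagonal_iff (y : Fin 2 → ℂ) :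
    y ∈ negCone (Matrix.diagonal ![(1 : ℂ), -1]) ↔ ‖y 0‖ ^ 2 < ‖y 1‖ ^ 2 := by
  change (hermForm (starRingEnd ℂ) (Matrix.diagonal ![(1 : ℂ), -1]) y y).re < 0 ↔ _
  rw [re_hermForm_diagonal_self, sub_neg]

/-- The boost matrix `!![conj y₁, y₀; conj y₀, y₁]` scales the form: `Mᴴ · diag(1,-1) · M = (|y₁|² − |y₀|²) · diag(1,-1)`.
[cite: Knapp2002, I §1] -/
theorem conjTranspose_boost_mul_diagonal_mul_boost (y : Fin 2 → ℂ) :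
    (!![conj (y 1), y 0; conj (y 0), y 1] : Matrix (Fin 2) (Fin 2) ℂ)ᴴ * Matrix.diagonal ![(1 : ℂ), -1] *
        !![conj (y 1), y 0; conj (y 0), y 1] =
      ((‖y 1‖ ^ 2 - ‖y 0‖ ^ 2 : ℝ) : ℂ) • Matrix.diagonal ![(1 : ℂ), -1] := by
  have h0 : conj (y 0) * y 0 = ((‖y 0‖ : ℝ) : ℂ) ^ 2 := Complex.conj_mul' (y 0)
  have h1 : conj (y 1) * y 1 = ((‖y 1‖ : ℝ) : ℂ) ^ 2 := Complex.conj_mul' (y 1)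
  ext i j
  fin_cases i <;> fin_cases j
  · simp [Matrix.mul_apply, Fin.sum_univ_two, Matrix.diagonal]
    linear_combination h1 - h0
  · simp [Matrix.mul_apply, Fin.sum_univ_two, Matrix.diagonal]
    ring
  · simp [Matrix.mul_apply, Fin.sum_univ_two, Matrix.diagonal]
    ring
  · simp [Matrix.mul_apply, Fin.sum_univ_two, Matrix.diagonal]
    linear_combination h0 - h1

/-- The determinant of the boost matrix: `det !![conj y₁, y₀; conj y₀, y₁] = |y₁|² − |y₀|²`. [cite: Knapp2002, I §1] -/
theorem det_boost (y : Fin 2 → ℂ) :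
    (!![conj (y 1), y 0; conj (y 0), y 1] : Matrix (Fin 2) (Fin 2) ℂ).det = ((‖y 1‖ ^ 2 - ‖y 0‖ ^ 2 : ℝ) : ℂ) := by
  rw [Matrix.det_fin_two_of, Complex.conj_mul', Complex.mul_conj']
  push_cast
  ring

/-- The boost matrix carries the base vector `e₁ = (0,1)` to `y`: `M · e₁ = y` (its second column). [cite: Knapp2002, I §1] -/
theorem boost_mulVec_single (y : Fin 2 → ℂ) :
    (!![conj (y 1), y 0; conj (y 0), y 1] : Matrix (Fin 2) (Fin 2) ℂ) *ᵥ Pi.single 1 1 = y := by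
  ext i
  fin_cases i <;> simp [Matrix.mulVec, dotProduct, Fin.sum_univ_two]

/-- **The boost**: for a negative vector `y` of `diag(1,-1)` there is `g ∈ U(diag(1,-1))` carrying the base vector
`e₁ = (0,1)` to the line of `y`: `g · e₁ = r⁻¹ · y` with `r = √(|y₁|² − |y₀|²) > 0` (namely `g = r⁻¹ · !![conj y₁, y₀; conj y₀, y₁]`).
[cite: Helgason1978, Ch. X §2] [cite: Knapp2002, I §1] -/
theorem exists_mem_unitaryGroupOfForm_diagonal_mulVec_single_eq {y : Fin 2 → ℂ}
    (hy : y ∈ negCone (Matrix.diagonal ![(1 : ℂ), -1])) :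
    ∃ g ∈ unitaryGroupOfForm (starRingEnd ℂ) (Matrix.diagonal ![(1 : ℂ), -1]), ∃ r : ℝ, 0 < r ∧
      ((g : GL (Fin 2) ℂ) : Matrix (Fin 2) (Fin 2) ℂ) *ᵥ Pi.single 1 1 = ((r⁻¹ : ℝ) : ℂ) • y := by
  rw [mem_negCone_diagonal_iff] at hy
  set s : ℝ := ‖y 1‖ ^ 2 - ‖y 0‖ ^ 2 with hs
  have hspos : 0 < s := sub_pos.2 hy
  set r : ℝ := Real.sqrt s with hr
  have hrpos : 0 < r := Real.sqrt_pos.2 hspos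
  have hrsq : r ^ 2 = s := Real.sq_sqrt hspos.le
  have hrne : (r : ℂ) ≠ 0 := Complex.ofReal_ne_zero.2 hrpos.ne'
  set M : Matrix (Fin 2) (Fin 2) ℂ := !![conj (y 1), y 0; conj (y 0), y 1] with hM
  set A : Matrix (Fin 2) (Fin 2) ℂ := ((r⁻¹ : ℝ) : ℂ) • M with hA
  have hdetM : M.det = ((s : ℝ) : ℂ) := det_boost y
  have hdetA : A.det = 1 := by
    rw [hA, Matrix.det_smul, hdetM, Fintype.card_fin, ← hrsq]
    push_cast
    field_simp
  have hdetA' : A.det ≠ 0 := by rw [hdetA]; exact one_ne_zero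
  refine ⟨Matrix.GeneralLinearGroup.mkOfDetNeZero A hdetA', ?_, r, hrpos, ?_⟩
  · rw [mem_unitaryGroupOfForm_star_iff_conjTranspose]
    change Aᴴ * Matrix.diagonal ![(1 : ℂ), -1] * A = Matrix.diagonal ![(1 : ℂ), -1]
    rw [hA, Matrix.conjTranspose_smul, Matrix.smul_mul, Matrix.smul_mul, Matrix.mul_smul, smul_smul,
      conjTranspose_boost_mul_diagonal_mul_boost, smul_smul, ← hs, ← hrsq]
    have hc : star (((r⁻¹ : ℝ) : ℂ)) * ((r⁻¹ : ℝ) : ℂ) * (((r ^ 2 : ℝ)) : ℂ) = 1 := by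
      rw [Complex.star_def, Complex.conj_ofReal]
      push_cast
      field_simp
    rw [hc, one_smul]
  · change A *ᵥ Pi.single 1 1 = _
    rw [hA, Matrix.smul_mulVec, boost_mulVec_single]

/-- Inverse action: `g⁻¹ (g x) = x` for `g ∈ GL₂(ℂ)` acting on `ℂ²` by `mulVec`. [folklore] -/
private theorem inv_mulVec_mulVec (g : GL (Fin 2) ℂ) (x : Fin 2 → ℂ) :
    ((g⁻¹ : GL (Fin 2) ℂ) : Matrix (Fin 2) (Fin 2) ℂ) *ᵥ (((g : GL (Fin 2) ℂ) : Matrix (Fin 2) (Fin 2) ℂ) *ᵥ x) = x := by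
  rw [mulVec_mulVec, ← Units.val_mul, inv_mul_cancel, Units.val_one, one_mulVec]

/-- `g (g⁻¹ x) = x` for `g ∈ GL₂(ℂ)`. [folklore] -/
private theorem mulVec_inv_mulVec (g : GL (Fin 2) ℂ) (x : Fin 2 → ℂ) :
    ((g : GL (Fin 2) ℂ) : Matrix (Fin 2) (Fin 2) ℂ) *ᵥ (((g⁻¹ : GL (Fin 2) ℂ) : Matrix (Fin 2) (Fin 2) ℂ) *ᵥ x) = x := by
  rw [mulVec_mulVec, ← Units.val_mul, mul_inv_cancel, Units.val_one, one_mulVec]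

/-- **Transitivity in the Sylvester frame**: for negative vectors `v, w` of `diag(1,-1)` there are `g ∈ U(diag(1,-1))`
and `c ≠ 0` with `g v = c · w` (compose the boost of `w` with the inverse boost of `v`).
[cite: Helgason1978, Ch. X §2] -/
theorem exists_mem_unitaryGroupOfForm_diagonal_mulVec_eq_smul {v w : Fin 2 → ℂ}
    (hv : v ∈ negCone (Matrix.diagonal ![(1 : ℂ), -1])) (hw : w ∈ negCone (Matrix.diagonal ![(1 : ℂ), -1])) :
    ∃ g ∈ unitaryGroupOfForm (starRingEnd ℂ) (Matrix.diagonal ![(1 : ℂ), -1]), ∃ c : ℂ, c ≠ 0 ∧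
      ((g : GL (Fin 2) ℂ) : Matrix (Fin 2) (Fin 2) ℂ) *ᵥ v = c • w := by
  obtain ⟨gv, hgv, rv, hrv, hv'⟩ := exists_mem_unitaryGroupOfForm_diagonal_mulVec_single_eq hv
  obtain ⟨gw, hgw, rw, hrw, hw'⟩ := exists_mem_unitaryGroupOfForm_diagonal_mulVec_single_eq hw
  refine ⟨gw * gv⁻¹, mul_mem hgw (inv_mem hgv), (rv : ℂ) * ((rw⁻¹ : ℝ) : ℂ),
    mul_ne_zero (Complex.ofReal_ne_zero.2 hrv.ne') (Complex.ofReal_ne_zero.2 (inv_ne_zero hrw.ne')), ?_⟩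
  -- `gv⁻¹ v = rv · e₁`
  have hinv : ((gv⁻¹ : GL (Fin 2) ℂ) : Matrix (Fin 2) (Fin 2) ℂ) *ᵥ v = (rv : ℂ) • Pi.single 1 1 := by
    have h := congrArg (fun x => ((gv⁻¹ : GL (Fin 2) ℂ) : Matrix (Fin 2) (Fin 2) ℂ) *ᵥ ((rv : ℂ) • x)) hv'
    simp only [mulVec_smul, inv_mulVec_mulVec, smul_smul] at h
    rw [← Complex.ofReal_mul, mul_inv_cancel₀ hrv.ne', Complex.ofReal_one, one_smul] at h
    exact h.symm
  rw [Units.val_mul, ← mulVec_mulVec, hinv, mulVec_smul, hw', smul_smul]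

end Diagonal

/-! ## §2 A hermitian plane of signature `(1,1)` presented by a frame -/

section Frame

variable {J : Matrix (Fin 2) (Fin 2) ℂ} {T : GL (Fin 2) ℂ}

/-- **Change of frame for the form**: `⟪u,u⟫_{Tᴴ J T} = ⟪T u, T u⟫_J`. [cite: BergeronMillsonMoeglin2016Balls, Part 2 §1.1] -/
theorem hermForm_formCongr_self (T : GL (Fin 2) ℂ) (J : Matrix (Fin 2) (Fin 2) ℂ) (u : Fin 2 → ℂ) :
    hermForm (starRingEnd ℂ) (formCongr (starRingEnd ℂ) T J) u u =
      hermForm (starRingEnd ℂ) J ((T : Matrix (Fin 2) (Fin 2) ℂ) *ᵥ u) ((T : Matrix (Fin 2) (Fin 2) ℂ) *ᵥ u) := by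
  rw [formCongr_star, hermForm_starRingEnd, hermForm_starRingEnd, ← mulVec_mulVec, ← mulVec_mulVec,
    dotProduct_mulVec, ← star_mulVec]

/-- **The frame carries the cone to the Sylvester cone**: `v ∈ negCone J → T⁻¹ v ∈ negCone (Tᴴ J T)`.
[cite: BergeronMillsonMoeglin2016Balls, Part 2 §1.3] -/
theorem inv_mulVec_mem_negCone {v : Fin 2 → ℂ} (hv : v ∈ negCone J) :
    ((T⁻¹ : GL (Fin 2) ℂ) : Matrix (Fin 2) (Fin 2) ℂ) *ᵥ v ∈ negCone (formCongr (starRingEnd ℂ) T J) := by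
  change (hermForm (starRingEnd ℂ) _ _ _).re < 0
  rw [hermForm_formCongr_self, mulVec_inv_mulVec]
  exact hv

/-- **`U(J)` is transitive on negative lines** (signature `(1,1)`): given a frame `Tᴴ J T = diag(1,-1)`, for all
`v, w ∈ negCone J` there are `g ∈ U(J)` and `c ≠ 0` with `g v = c · w`.  (In the frame the statement is
`exists_mem_unitaryGroupOfForm_diagonal_mulVec_eq_smul`; transport by `g ↦ T g T⁻¹`, ★ `conj_mem_unitaryGroupOfForm`.)
This is «`U(1,1)` acts transitively on the disc of negative lines», the rank-2 case of BMM Part 2 §1.3.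
[cite: Helgason1978, Ch. X §2] [cite: BergeronMillsonMoeglin2016Balls, Part 2 §1.3] -/
theorem exists_mem_unitaryGroupOfForm_mulVec_eq_smul (hT : formCongr (starRingEnd ℂ) T J = Matrix.diagonal ![(1 : ℂ), -1])
    {v w : Fin 2 → ℂ} (hv : v ∈ negCone J) (hw : w ∈ negCone J) :
    ∃ g ∈ unitaryGroupOfForm (starRingEnd ℂ) J, ∃ c : ℂ, c ≠ 0 ∧
      ((g : GL (Fin 2) ℂ) : Matrix (Fin 2) (Fin 2) ℂ) *ᵥ v = c • w := by
  have hv₁ := inv_mulVec_mem_negCone (T := T) hv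
  have hw₁ := inv_mulVec_mem_negCone (T := T) hw
  rw [hT] at hv₁ hw₁
  obtain ⟨g₁, hg₁, c, hc, hg₁v⟩ := exists_mem_unitaryGroupOfForm_diagonal_mulVec_eq_smul hv₁ hw₁
  rw [← hT] at hg₁
  refine ⟨T * g₁ * T⁻¹, conj_mem_unitaryGroupOfForm (starRingEnd ℂ) T J hg₁, c, hc, ?_⟩
  rw [Units.val_mul, Units.val_mul, ← mulVec_mulVec, ← mulVec_mulVec, hg₁v, mulVec_smul, mulVec_inv_mulVec]

/-- **Every negative line is reached from any base vector**: for `v₀, w ∈ negCone J` some `g ∈ U(J)` has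
`g v₀ ∈ ℂˣ · w` — the surjectivity of the orbit map `U(J) → negCone J / ℂˣ`, `g ↦ [g v₀]`, used for compact
fundamental sets.  (Restatement of `exists_mem_unitaryGroupOfForm_mulVec_eq_smul` with the scalar on the other side.)
[cite: Helgason1978, Ch. X §2] -/
theorem exists_mem_unitaryGroupOfForm_smul_mulVec_eq (hT : formCongr (starRingEnd ℂ) T J = Matrix.diagonal ![(1 : ℂ), -1])
    {v₀ w : Fin 2 → ℂ} (hv₀ : v₀ ∈ negCone J) (hw : w ∈ negCone J) :
    ∃ g ∈ unitaryGroupOfForm (starRingEnd ℂ) J, ∃ c : ℂ, c ≠ 0 ∧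
      c • (((g : GL (Fin 2) ℂ) : Matrix (Fin 2) (Fin 2) ℂ) *ᵥ v₀) = w := by
  obtain ⟨g, hg, c, hc, h⟩ := exists_mem_unitaryGroupOfForm_mulVec_eq_smul hT hv₀ hw
  refine ⟨g, hg, c⁻¹, inv_ne_zero hc, ?_⟩
  rw [h, smul_smul, inv_mul_cancel₀ hc, one_smul]

end Frame

end Literature.NumberTheory.Automorphic

end
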